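import Summits.QuantumFields.YangMills.Theses.BalabanLadder

/-!
# Route BalabanLadder — the assembly item, closed by the route's deciding theorem

`Summit.QuantumFields.YangMills.Theses.BalabanLadder.Assembly` is the registered assembly statement
`UV → UVSeamRec → NT → IR → ROT → UVOtherGroups → YangMills` (item stmt-QuantumFields-20041, rank 1 of
route-QuantumFields-BalabanLadder, rev 2) — in the route file's own words, "literally the type of the deciding
theorem `closes`".  This file records that fact as a sorry-free term so the item closes by name.
HONEST FRAMING: pure bookkeeping — the six cruxes (UV, UVSeamRec, NT, IR, ROT, UVOtherGroups) remain the route's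
entire open content and nothing here bears on any of them; no summit claim of any kind.
-/

namespace Summit.QuantumFields.YangMills.Theorems

/-- The assembly item of route BalabanLadder: the cruxes in rank order imply the sub-problem statement
`YangMills` — by the route's deciding theorem `BalabanLadder.closes`. -/
theorem BalabanLadder_Assembly_proof :
    Summit.QuantumFields.YangMills.Theses.BalabanLadder.Assembly := by
  unfold Summit.QuantumFields.YangMills.Theses.BalabanLadder.Assembly
  intro hUV hSeam hNT hIR hROT hOther
  -- rev 12 of the route file (2026-08-28T08:18Z, R423/R424) re-keyed `closes` to the COFINAL leg `IRcof`;
  -- `IR → IRcof` by taking all couplings (`Bset = univ`, cf. `CofinalLeaf.IRcof_of_IR`); the assembly statement is unchanged.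
  refine Summit.QuantumFields.YangMills.Theses.BalabanLadder.closes hUV hSeam hNT ?_ hROT hOther
  intro G _ _ _ _ hG
  letI : MeasurableSpace G := borel G
  haveI : BorelSpace G := ⟨rfl⟩
  intro r a ha ha0 hlb
  obtain ⟨c₁, β₂, S₁, hc₁, hC⟩ := hIR G hG r a ha ha0 hlb
  refine ⟨Set.univ, fun x => ⟨x, Set.mem_univ x, le_rfl⟩, c₁, β₂, S₁, hc₁, fun A B => ?_⟩
  obtain ⟨C, hC'⟩ := hC A B
  exact ⟨C, fun β _ hβ S n hS hn => hC' β hβ S n hS hn⟩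

end Summit.QuantumFields.YangMills.Theorems
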